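import Summits.MatrixMultiplication.MatrixMultiplication.Theorems.SoloBlindConjETwo

/-!
# (K₃) and Conjecture E at corank at most two — packaged

Sub-programme (K₃) / Conjecture E.  The kernel ladder (`SoloBlindCorankOneKraft`, `SoloBlindCorankOne`,
`SoloBlindCorankTwoKraft`, `SoloBlindConjETwo`) packaged as single statements over an arbitrary index set
`S ⊇ B` with `|S \ B| ≤ 2` and `B` sum-distinct (`G` of exponent `3`):

* `soloBlind_kraft_corank_le_two` — `h` zero-sum free on `S` ⟹ `K(τ; S) ≤ 1` for every `τ`;
* `soloBlind_conjE_corank_le_two` — additionally `τ` H-good on `S` ⟹ `E(τ; S) ≤ 1/2`.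

Over `𝔽₃` a sum-distinct `B` is a linearly independent one (`soloBlind_signed_sumDistinct`), so these are (K₃) and
Conjecture E for all zero-sum-free sequences of length `≤ rank + 2`, in every rank.
-/

namespace Summit.MatrixMultiplication.MatrixMultiplication.Theorems

open Finset

universe u

variable {ι : Type*} [DecidableEq ι]
variable {G : Type u} [AddCommGroup G] [DecidableEq G]

omit [DecidableEq G] in
/-- `S = B ∪ (S \ B)` rewritten through an enumeration of `S \ B` of size `≤ 2`. -/
theorem soloBlind_shape_of_sdiff_card_le_two {S B : Finset ι} (hBS : B ⊆ S) (hc : (S \ B).card ≤ 2) :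
    S = B ∨ (∃ p, p ∉ B ∧ S = insert p B) ∨ (∃ p q, p ∉ B ∧ q ∉ B ∧ p ≠ q ∧ S = insert q (insert p B)) := by
  have hS : S = B ∪ (S \ B) := (Finset.union_sdiff_of_subset hBS).symm
  rcases Nat.lt_or_ge (S \ B).card 1 with h0 | h1
  · left
    have e : S \ B = ∅ := Finset.card_eq_zero.mp (show (S \ B).card = 0 by omega)
    rw [hS, e, Finset.union_empty]
  · right
    rcases Nat.lt_or_ge (S \ B).card 2 with h1' | h2
    · left
      obtain ⟨p, hp⟩ := Finset.card_eq_one.mp (show (S \ B).card = 1 by omega)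
      have hpB : p ∉ B := by
        have : p ∈ S \ B := by rw [hp]; exact Finset.mem_singleton_self p
        exact (Finset.mem_sdiff.mp this).2
      refine ⟨p, hpB, ?_⟩
      rw [hS, hp, Finset.union_comm, ← Finset.insert_eq]
    · right
      obtain ⟨p, q, hpq, hpqE⟩ := Finset.card_eq_two.mp (show (S \ B).card = 2 by omega)
      have hpB : p ∉ B := by
        have : p ∈ S \ B := by rw [hpqE]; simp
        exact (Finset.mem_sdiff.mp this).2
      have hqB : q ∉ B := by
        have : q ∈ S \ B := by rw [hpqE]; simp
        exact (Finset.mem_sdiff.mp this).2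
      refine ⟨p, q, hpB, hqB, hpq, ?_⟩
      rw [hS, hpqE, Finset.union_comm, Finset.insert_eq, Finset.insert_eq, Finset.insert_eq,
        Finset.union_assoc, Finset.union_left_comm]

/-- (K₃) AT CORANK AT MOST TWO (every rank, exponent `3`): `B ⊆ S` sum-distinct with `|S \ B| ≤ 2` and `h` zero-sum
free on `S` ⟹ `K(τ; S) ≤ 1` for every `τ`. -/
theorem soloBlind_kraft_corank_le_two (three : ∀ g : G, g + g + g = 0) {h : ι → G} {S B : Finset ι}
    (hBS : B ⊆ S) (hc : (S \ B).card ≤ 2)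
    (hdist : ∀ A ⊆ B, ∀ A' ⊆ B, ∑ i ∈ A, h i = ∑ i ∈ A', h i → A = A')
    (zsf : ∀ T ⊆ S, T.Nonempty → ∑ i ∈ T, h i ≠ 0) (τ : G) : soloBlindMass h S τ ≤ 1 := by
  rcases soloBlind_shape_of_sdiff_card_le_two hBS hc with rfl | ⟨p, hpB, rfl⟩ | ⟨p, q, hpB, hqB, hpq, rfl⟩
  · exact soloBlind_mass_le_one_of_sumDistinct hdist τ
  · exact soloBlind_kraft_corank_one hpB hdist zsf τ
  · exact soloBlind_kraft_corank_two three hpB hqB hpq hdist zsf τ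

/-- CONJECTURE E AT CORANK AT MOST TWO (every rank, exponent `3`): `B ⊆ S` sum-distinct with `|S \ B| ≤ 2`, `h`
zero-sum free on `S`, `τ` H-good on `S` ⟹ `E(τ; S) ≤ 1/2`. -/
theorem soloBlind_conjE_corank_le_two (three : ∀ g : G, g + g + g = 0) {h : ι → G} {S B : Finset ι}
    (hBS : B ⊆ S) (hc : (S \ B).card ≤ 2)
    (hdist : ∀ A ⊆ B, ∀ A' ⊆ B, ∑ i ∈ A, h i = ∑ i ∈ A', h i → A = A')
    (zsf : ∀ T ⊆ S, T.Nonempty → ∑ i ∈ T, h i ≠ 0) {τ : G} (hgood : ∀ T ⊆ S, ∑ i ∈ T, h i ≠ τ + τ) :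
    soloBlindMass h S τ ≤ 1 / 2 := by
  rcases soloBlind_shape_of_sdiff_card_le_two hBS hc with rfl | ⟨p, hpB, rfl⟩ | ⟨p, q, hpB, hqB, hpq, rfl⟩
  · -- corank zero: the unique representation of `τ ≠ 0` is nonempty
    have e := soloBlind_mass_le_pow_of_card_le_one h S τ 1 (soloBlind_repAll_card_le_one_of_sumDistinct hdist τ)
      (fun T hT => by
        rw [Nat.one_le_iff_ne_zero, Ne, Finset.card_eq_zero]
        rintro rfl
        obtain ⟨-, hTs⟩ := soloBlind_mem_seqRepAll.mp hT
        rw [Finset.sum_empty] at hTs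
        exact hgood ∅ (Finset.empty_subset _) (by rw [Finset.sum_empty, ← hTs, add_zero]))
    rwa [pow_one] at e
  · exact soloBlind_conjE_corank_one hpB hdist zsf hgood
  · exact soloBlind_conjE_corank_two three hpB hqB hpq hdist zsf hgood

end Summit.MatrixMultiplication.MatrixMultiplication.Theorems
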